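import Mathlib
import Literature.RepresentationTheory.FiniteGroups.PlancherelFewRowsTail
import Summits.MatrixMultiplication.MatrixMultiplication.Theorems.SnSubsetDichotomyNoThresholdSubsetTripleStubDurfeeShapeLayers
import HarnessLib

/-!
# `SnSubsetDichotomy.NoThresholdSubsetTriple`, line `klr-graded-polynomial-method`:
# stub `stub_durfeeShape` (the Durfee-square tail of the Plancherel measure, per shape, on the box)

For a partition `μ ⊢ N` inside the `3√N`-box (`λ_0, λ'_0 < 3√N`) whose Durfee square
`d(μ) = #{j : (j, j) ∈ μ}` is large, `d(μ) ≥ (27/40)√N`, the dimension `f^μ` is exponentially small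
in Plancherel measure: `(f^μ)² ≤ N! · e^{-κN}` for `N ≥ n₀` (`κ = 1/(24 · 240³)`).

This is the Logan–Shepp / Vershik–Kerov "macroscopic deviation from the limit shape costs `e^{-cN}`"
mechanism, in the layer form of the tree (`PlancherelFewRowsTail.lsvk_inequality_fewRows`, same
set-up verbatim: `a = 2√N`, `p` the ascending-slot indicator of the rotated boundary,
`η = p - F_a`, `J(μ) = 𝔅(F_a, 1 - F_a) + [linear ≥ 0] - 𝔅(η, η)`,
`-𝔅(η, η) ≥ ½ ∫₀^{R₀} s⁻² D(s) ds`). The Logan–Shepp–Vershik–Kerov curve crosses the anti-diagonal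
at `d/√N → 2/π = 0.6366…`; here the information on `η` is an integral one:
`g(0) := ∫_{-R}^{0} η = d - a/π ≥ (27/40 - 2/3)√N = √N/120` (`∫_{-R}^0 p = d`,
`∫_{-a}^0 F_a = a/π`, `π > 3`). Since `|η| ≤ 1` and `η = 0` left of `-R`, every window
`[x, x + s]` with `x ≤ -R` and `x + s ∈ [-w, 0]`, `w = √N/240`, has `∫_x^{x+s} η ≥ 2w - w = w`, so for
every scale `s ∈ (R, 2R)` an `x`-interval of length `w` has squared window integral `≥ w²`, giving
`∫₀^{2R} s⁻² D(s) ds ≥ w³/(4R) ≥ N/(12 · 240³)` on the box (`R < 3√N`), hence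
`J(μ) ≥ ½(N log N - N) + N/(24 · 240³)`; the hook length formula and Stirling finish as in
`sq_numStandardTableaux_le_of_fewRows`.

References: A. M. Vershik, S. V. Kerov, Funct. Anal. Appl. 19 (1985) §3 [VershikKerov1985];
B. F. Logan, L. A. Shepp, Adv. Math. 26 (1977) [LoganShepp1977]; D. Romik, *The Surprising
Mathematics of Longest Increasing Subsequences* (2014) §1.17.
-/

-- `Summit.<Summit>.<Problem>`: summit and problem coincide for this single-conjunct summit.
set_option linter.dupNamespace false

noncomputable section

open MeasureTheory Set Filter intervalIntegral
open scoped Real Topology Interval BigOperators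

namespace Summit.MatrixMultiplication.MatrixMultiplication.Theorems

namespace DurfeeShape

open Literature.RepresentationTheory.FiniteGroups
open Literature.RepresentationTheory.FiniteGroups.VershikKerov
open Literature.Analysis.Potential
open Literature.NumberTheory.DiophantineGeometry (numStandardTableaux hookLength one_le_hookLength
  numStandardTableaux_mul_prod_hookLength_holds)

/-- **The Durfee-square inequality for the hook integral (Vershik–Kerov 1985 §3 / Logan–Shepp 1977
mechanism, layer form).** For `N ≥ 1` and `μ ⊢ N` with `λ_0, λ'_0 < 3√N` and
`#{j : (j, j) ∈ μ} ≥ (27/40)√N`: `J(μ) ≥ ½(N log N - N) + N/(24 · 240³)`.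
Proof: as in the tree's `lsvk_inequality_fewRows`, with the layer lower bound coming from the
windows `[x, x+s]`, `s ∈ (R, 2R)`, `x ∈ [-s - w, -s]`, `w = √N/240`, on which
`∫_x^{x+s} η = ∫_{-R}^{0} η - ∫_{x+s}^{0} η ≥ √N/120 - w = w`
(`∫_{-R}^0 η = d - a/π`, `integral_ascSlot_neg_zero`, `integral_arcsineCDF_neg_zero`).
[cite: VershikKerov1985, §3] -/
theorem lsvk_inequality_durfee (N : ℕ) (hN : 1 ≤ N) (μ : Nat.Partition N)
    (hrow : (μ.youngDiagram.rowLen 0 : ℝ) < 3 * Real.sqrt N)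
    (hcol : (μ.youngDiagram.colLen 0 : ℝ) < 3 * Real.sqrt N)
    (hd : (27 : ℝ) / 40 * Real.sqrt N ≤
      (((Finset.range N).filter (fun j : ℕ => (j, j) ∈ μ.youngDiagram)).card : ℝ)) :
    ((N : ℝ) * Real.log N - N) / 2 + N / (24 * 240 ^ 3) ≤ vkJCells μ := by
  -- Set-up (`Y, a, R, F, φ, η`, neutrality, equal areas, signs) repeated verbatim from the tree's
  -- `lsvk_inequality_fewRows` (adapted from `PlancherelFewRowsTail.lean`).
  have hπ := Real.pi_pos
  have hπ3 := Real.pi_gt_three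
  set Y := μ.youngDiagram with hY
  have hcard : Y.cells.card = N := μ.card_cells_youngDiagram
  set a : ℝ := 2 * Real.sqrt N with ha
  have hN0 : (0:ℝ) < N := by exact_mod_cast hN
  have hsqrt : 0 < Real.sqrt N := Real.sqrt_pos.mpr hN0
  have ha0 : 0 < a := by positivity
  have hsq : Real.sqrt (N : ℝ) ^ 2 = N := Real.sq_sqrt hN0.le
  have hsqrt1 : 1 ≤ Real.sqrt N := by
    rw [show (1:ℝ) = Real.sqrt 1 from Real.sqrt_one.symm]
    exact Real.sqrt_le_sqrt (by exact_mod_cast hN)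
  set R : ℕ := max (max (Y.rowLen 0) (Y.colLen 0)) ⌈a⌉₊ with hR
  have hR₁ : Y.rowLen 0 ≤ R := (le_max_left _ _).trans (le_max_left _ _)
  have hR₂ : Y.colLen 0 ≤ R := (le_max_right _ _).trans (le_max_left _ _)
  have haR : a ≤ R := (Nat.le_ceil a).trans (by exact_mod_cast le_max_right _ _)
  have hR0 : (0:ℝ) ≤ R := Nat.cast_nonneg R
  have hRpos : (0:ℝ) < R := lt_of_lt_of_le ha0 haR
  -- ON THE BOX: `R < 3√N`
  have hR3 : (R : ℝ) < 3 * Real.sqrt N := by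
    have hceil : (⌈a⌉₊ : ℝ) < a + 1 := Nat.ceil_lt_add_one ha0.le
    rw [hR]
    push_cast
    exact max_lt (max_lt hrow hcol) (by linarith)
  set F : ℝ → ℝ := arcsineCDF a with hF
  set φ : ℝ → ℝ := ascSlot Y R with hφ
  set η : ℝ → ℝ := fun x => φ x - F x with hη
  -- properties of `η`
  have hηm : Measurable η := (measurable_ascSlot R).sub (continuous_arcsineCDF a).measurable
  have hηC : ∀ x, |η x| ≤ 1 := by
    intro x
    simp only [hη, hφ, hF]
    rw [abs_le]
    constructor <;> linarith [ascSlot_nonneg (Y := Y) R x, ascSlot_le_one (Y := Y) R x,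
      arcsineCDF_nonneg a x, arcsineCDF_le_one a x]
  have hη0 : ∀ x ∉ Icc (-(R : ℝ)) R, η x = 0 := by
    intro x hx
    simp only [hη, hφ, hF]
    rcases not_and_or.mp hx with h | h
    · have hx' : x < -(R : ℝ) := not_le.mp h
      rw [ascSlot_of_lt_neg hR₂ hx', arcsineCDF_of_le_neg ha0 (by linarith)]; ring
    · have hx' : (R : ℝ) < x := not_le.mp h
      rw [ascSlot_of_le hx'.le, arcsineCDF_of_le ha0 (by linarith)]; ring
  have hRR : -(R : ℝ) ≤ R := by linarith
  have hred : ∀ {g : ℝ → ℝ}, (∀ x ∉ Icc (-(R : ℝ)) R, g x = 0) →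
      ∫ x, g x = ∫ x in (-(R : ℝ))..R, g x := by
    intro g hg
    rw [integral_of_le hRR, ← integral_Icc_eq_integral_Ioc]
    exact (setIntegral_eq_integral_of_forall_compl_eq_zero fun x hx => hg x hx).symm
  -- charge neutrality `∫ η = 0`
  have hint0 : ∫ x, η x = 0 := by
    rw [hred hη0]
    simp only [hη, hφ, hF]
    rw [intervalIntegral.integral_sub (intervalIntegrable_ascSlot R _ _)
      ((continuous_arcsineCDF a).intervalIntegrable _ _), integral_ascSlot hR₂, integral_arcsineCDF]
    ring
  -- equal areas `∫ x η(x) dx = 0`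
  have hint1 : ∫ x, x * η x = 0 := by
    rw [hred (g := fun x => x * η x) fun x hx => by rw [hη0 x hx, mul_zero] ]
    have hsplit : ∀ x, x * η x = x * ascSlot Y R x - x * arcsineCDF a x := fun x => by
      simp only [hη, hφ, hF]; ring
    simp_rw [hsplit]
    have hi1 : IntervalIntegrable (fun x => x * ascSlot Y R x) volume (-(R : ℝ)) R :=
      (intervalIntegrable_ascSlot R _ _).continuousOn_mul continuous_id.continuousOn
    have hi2 : IntervalIntegrable (fun x => x * arcsineCDF a x) volume (-(R : ℝ)) R :=
      (continuous_id.mul (continuous_arcsineCDF a)).intervalIntegrable _ _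
    rw [intervalIntegral.integral_sub hi1 hi2,
      integral_id_mul_ascSlot hR₁ hR₂, integral_id_mul_arcsineCDF ha0 haR, hcard, ha]
    nlinarith [hsq]
  -- signs outside `[-a, a]`
  have hpos : ∀ x, x < -a → 0 ≤ η x := fun x hx => by
    simp only [hη, hφ, hF]
    rw [arcsineCDF_of_le_neg ha0 hx.le, sub_zero]; exact ascSlot_nonneg R x
  have hneg : ∀ x, a < x → η x ≤ 0 := fun x hx => by
    simp only [hη, hφ, hF]
    rw [arcsineCDF_of_le ha0 hx.le]; linarith [ascSlot_le_one (Y := Y) R x]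
  have hi : ∀ b c, IntervalIntegrable η volume b c := fun b c =>
    (integrable_of_bounded_Icc hηm hηC hη0).intervalIntegrable
  -- (1) the charge left of the origin: `∫_{-R}^{0} η = d - a/π ≥ √N/120`
  have hg0 : Real.sqrt N / 120 ≤ ∫ x in (-(R:ℝ))..0, η x := by
    have hsplit : ∫ x in (-(R:ℝ))..0, η x =
        (∫ x in (-(R:ℝ))..0, ascSlot Y R x) - ∫ x in (-(R:ℝ))..0, arcsineCDF a x := by
      simp only [hη, hφ, hF]
      exact intervalIntegral.integral_sub (intervalIntegrable_ascSlot R _ _)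
        ((continuous_arcsineCDF a).intervalIntegrable _ _)
    rw [hsplit, integral_ascSlot_neg_zero hR₂, integral_arcsineCDF_neg_zero ha0 haR,
      filter_diag_eq_of_rowLen_le (M := N) hR₁ ((rowLen_zero_le_card Y).trans hcard.le)]
    have h1 : a / π ≤ 2 * Real.sqrt N / 3 := by
      rw [ha, div_le_div_iff₀ hπ (by norm_num)]
      nlinarith
    linarith [hd]
  -- (2) the windows: for `s ∈ (R, 2R)` and `x ∈ [-s - w, -s]`, `(∫_x^{x+s} η)² ≥ w²`
  set w : ℝ := Real.sqrt N / 240 with hw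
  have hw0 : 0 < w := by positivity
  have hwin : ∀ s ∈ Ioo (R:ℝ) (2 * R), ∀ x ∈ Icc (-s - w) (-s - w + w),
      w ^ 2 ≤ (∫ t in x..x + s, η t) ^ 2 := by
    intro s hs x hx
    have hx1 : x < -(R:ℝ) := by linarith [hx.2, hs.1]
    have hy1 : -w ≤ x + s := by linarith [hx.1]
    have hy2 : x + s ≤ 0 := by linarith [hx.2]
    -- `η` vanishes left of `-R`
    have hleft : ∫ t in x..(-(R:ℝ)), η t = 0 := by
      rw [integral_of_le hx1.le, integral_Ioc_eq_integral_Ioo]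
      refine (setIntegral_congr_fun measurableSet_Ioo fun t ht => ?_).trans (integral_zero _ _)
      exact hη0 t fun h => by linarith [h.1, ht.2]
    have hsplit1 : ∫ t in x..x + s, η t = ∫ t in (-(R:ℝ))..x + s, η t := by
      rw [← integral_add_adjacent_intervals (hi x (-(R:ℝ))) (hi (-(R:ℝ)) (x + s)), hleft,
        zero_add]
    have hsplit2 : ∫ t in (-(R:ℝ))..x + s, η t =
        (∫ t in (-(R:ℝ))..0, η t) - ∫ t in (x + s)..0, η t := by
      rw [← integral_add_adjacent_intervals (hi (-(R:ℝ)) (x + s)) (hi (x + s) 0)]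
      ring
    have htail : |∫ t in (x + s)..0, η t| ≤ w := by
      have h := norm_integral_le_of_norm_le_const (a := x + s) (b := 0) (C := 1) (f := η)
        fun t _ => by rw [Real.norm_eq_abs]; exact hηC t
      rw [Real.norm_eq_abs] at h
      calc |∫ t in (x + s)..0, η t| ≤ 1 * |0 - (x + s)| := h
        _ = -(x + s) := by rw [one_mul, zero_sub, abs_neg, abs_of_nonpos hy2]
        _ ≤ w := by linarith
    have hge : w ≤ ∫ t in x..x + s, η t := by
      rw [hsplit1, hsplit2]
      have h2w : 2 * w ≤ ∫ t in (-(R:ℝ))..0, η t := by rw [hw]; linarith [hg0]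
      linarith [le_abs_self (∫ t in (x + s)..0, η t)]
    exact pow_le_pow_left₀ hw0.le hge 2
  -- (3) the analytic inputs
  have hQ1 := integral_sq_div_sq_le_neg_logEnergy_of_pos hηm hηC hη0 hR0
    (by linarith : (0:ℝ) < 2 * R) hint0
  have hQ2 := mul_sq_layers_le_integral_sq_div_sq η 1 R hηm hηC hη0 hR0 R (2 * R) w w
    (fun s => -s - w) hR0 (by linarith) hw0.le hwin
  have hB1 := hookForm_self_eq_half_logEnergy hηm hηC hη0 hR0
  have hrate : (N : ℝ) / (12 * 240 ^ 3) ≤ w * w ^ 2 * (2 * R - R) / (2 * R) ^ 2 := by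
    have h1 : w * w ^ 2 * (2 * R - R) / (2 * R) ^ 2 = w ^ 3 / (4 * R) := by
      field_simp
      ring
    have h2 : w ^ 3 / (12 * Real.sqrt N) ≤ w ^ 3 / (4 * R) :=
      div_le_div_of_nonneg_left (by positivity) (by positivity) (by linarith [hR3])
    have h3 : w ^ 3 / (12 * Real.sqrt N) = N / (12 * 240 ^ 3) := by
      rw [hw, div_pow, pow_succ, hsq]
      field_simp
    rw [h1, ← h3]
    exact h2
  have hLin : 0 ≤ (∫ p : ℝ × ℝ, upperLogKernel p * η p.1 * (1 - arcsineCDF a p.2)) -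
      ∫ p : ℝ × ℝ, upperLogKernel p * arcsineCDF a p.1 * η p.2 := by
    rw [hookForm_linear_eq hηm hηC hη0 hR0 ha0]
    exact integral_mul_arcsineLinPot_nonneg hηm hηC hη0 ha0 hint0 hint1 hpos hneg
  have hΩ : ∫ p : ℝ × ℝ, upperLogKernel p * arcsineCDF a p.1 * (1 - arcsineCDF a p.2) =
      ((N : ℝ) * Real.log N - N) / 2 := by
    rw [hookForm_arcsine ha0, ha, show 2 * Real.sqrt N / 2 = Real.sqrt N by ring,
      Real.log_sqrt hN0.le, show (2 * Real.sqrt (N : ℝ)) ^ 2 / 4 = N by rw [mul_pow, hsq]; ring]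
    ring
  have hexp := hookForm_expand ha0 haR hηm hηC hη0 (φ := φ) (fun x => by simp only [hη]; ring)
  have hJ : vkJCells μ = ∫ p : ℝ × ℝ, upperLogKernel p * φ p.1 * (1 - φ p.2) := by
    rw [vkJCells, sum_vkHookKernel_eq_hookForm hR₁ hR₂]
    refine integral_congr_ae (Eventually.of_forall fun p => ?_)
    simp only [hφ]
    rw [← ascSlot_add_descSlot hR₁ hR₂ p.2]
    ring
  rw [hJ, hexp, hΩ, hB1]
  linarith

/-- **Per-shape bound.** For `N ≥ 1` and `μ ⊢ N` in the `3√N`-box with `#{j : (j,j) ∈ μ} ≥ (27/40)√N`: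
`(f^μ)² ≤ N! · exp(½ log N + 1 - 2N/(24 · 240³))` (hook length formula `f^μ ∏ h = N!`,
`log ∏ h ≥ J(μ) ≥ ½(N log N - N) + N/(24·240³)`, Stirling `log N! ≤ N log N - N + ½ log N + 1`;
as the tree's `sq_numStandardTableaux_le_of_fewRows`). [cite: VershikKerov1985, §3] -/
theorem sq_numStandardTableaux_le_of_durfee (N : ℕ) (hN : 1 ≤ N) (μ : Nat.Partition N)
    (hrow : (μ.youngDiagram.rowLen 0 : ℝ) < 3 * Real.sqrt N)
    (hcol : (μ.youngDiagram.colLen 0 : ℝ) < 3 * Real.sqrt N)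
    (hd : (27 : ℝ) / 40 * Real.sqrt N ≤
      (((Finset.range N).filter (fun j : ℕ => (j, j) ∈ μ.youngDiagram)).card : ℝ)) :
    ((numStandardTableaux μ : ℕ) : ℝ) ^ 2 ≤
      (N.factorial : ℝ) * Real.exp (Real.log N / 2 + 1 - 2 * (1 / (24 * 240 ^ 3)) * N) := by
  set H : ℝ := ∏ c ∈ μ.youngDiagram.cells, (hookLength μ.youngDiagram c : ℝ) with hH
  have hHpos : 0 < H := Finset.prod_pos fun c hc => by exact_mod_cast one_le_hookLength hc
  have hfac : (0 : ℝ) < N.factorial := by exact_mod_cast N.factorial_pos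
  have hfH : (numStandardTableaux μ : ℝ) * H = N.factorial := by
    have h := numStandardTableaux_mul_prod_hookLength_holds (d := N) μ
    rw [hH]
    exact_mod_cast h
  have h1 := vkJCells_le_log_prod_hookLength μ
  have h2 := lsvk_inequality_durfee N hN μ hrow hcol hd
  have h4 := log_factorial_le hN
  set E : ℝ := Real.log N / 2 + 1 - 2 * (1 / (24 * 240 ^ 3)) * N with hE
  have key : Real.log (N.factorial : ℝ) ≤ E + 2 * Real.log H := by
    rw [hE]; rw [← hH] at h1
    have : (N : ℝ) / (24 * 240 ^ 3) = 1 / (24 * 240 ^ 3) * N := by ring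
    linarith
  have hmain : (N.factorial : ℝ) ≤ Real.exp E * H ^ 2 := by
    calc (N.factorial : ℝ) = Real.exp (Real.log (N.factorial : ℝ)) := (Real.exp_log hfac).symm
      _ ≤ Real.exp (E + 2 * Real.log H) := Real.exp_le_exp.mpr key
      _ = Real.exp E * H ^ 2 := by
          have hlog2 : 2 * Real.log H = Real.log (H ^ 2) := by
            rw [Real.log_pow]; norm_num
          rw [Real.exp_add, hlog2, Real.exp_log (pow_pos hHpos 2)]
  have hf : (numStandardTableaux μ : ℝ) = N.factorial / H := by
    rw [eq_div_iff hHpos.ne']; exact hfH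
  rw [hf, div_pow, div_le_iff₀ (pow_pos hHpos 2)]
  calc (N.factorial : ℝ) ^ 2 = N.factorial * N.factorial := by ring
    _ ≤ N.factorial * (Real.exp E * H ^ 2) := mul_le_mul_of_nonneg_left hmain hfac.le
    _ = N.factorial * Real.exp E * H ^ 2 := by ring

end DurfeeShape

open DurfeeShape in
/-- **Stub `stub_durfeeShape` (line `klr-graded-polynomial-method`, crux
`SnSubsetDichotomy.NoThresholdSubsetTriple`, stmt-MatrixMultiplication-8302): the Durfee-square
tail of the Plancherel measure, per shape, on the `3√n`-box.** There are `κ > 0` and `n₀` such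
that for `n ≥ n₀` every `μ ⊢ n` with `λ_0, λ'_0 < 3√n` and `#{j : (j, j) ∈ μ} ≥ (27/40)√n` has
`(f^μ)² ≤ n! · e^{-κn}` (here `κ = 1/(24 · 240³)`): by `sq_numStandardTableaux_le_of_durfee`,
`(f^μ)² ≤ n! e^{½ log n + 1 - 2κn}`, and `½ log n + 1 ≤ √n + 1 ≤ κn` once `√n ≥ 2/κ`.
The Logan–Shepp–Vershik–Kerov limit shape has `d/√n → 2/π < 27/40`, so this is a macroscopic
deviation and costs `e^{-cn}` (Vershik–Kerov 1985 §3; Romik 2014, §1.17).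
[cite: VershikKerov1985, §3] -/
theorem stub_durfeeShape : ∃ κ : ℝ, 0 < κ ∧ ∃ n₀ : ℕ, ∀ n ≥ n₀, ∀ μ : Nat.Partition n, (μ.youngDiagram.rowLen 0 : ℝ) < 3 * Real.sqrt (n : ℝ) → (μ.youngDiagram.colLen 0 : ℝ) < 3 * Real.sqrt (n : ℝ) → (27 : ℝ) / 40 * Real.sqrt (n : ℝ) ≤ (((Finset.range n).filter (fun j : ℕ => (j, j) ∈ μ.youngDiagram)).card : ℝ) → ((Literature.NumberTheory.DiophantineGeometry.numStandardTableaux μ : ℕ) : ℝ) ^ 2 ≤ (n.factorial : ℝ) * Real.exp (-(κ * (n : ℝ))) := by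
  obtain ⟨κ, hκ⟩ : ∃ κ : ℝ, κ = 1 / (24 * 240 ^ 3) := ⟨_, rfl⟩
  have hκ0 : 0 < κ := by rw [hκ]; positivity
  obtain ⟨M, hM⟩ : ∃ M : ℝ, M = 2 / κ := ⟨_, rfl⟩
  have hM0 : 0 < M := by rw [hM]; positivity
  refine ⟨κ, hκ0, ⌈M ^ 2⌉₊ + 1, fun n hn μ hrow hcol hd => ?_⟩
  have hn1 : 1 ≤ n := le_trans (Nat.le_add_left 1 _) hn
  have hn0 : (0 : ℝ) < n := by exact_mod_cast hn1
  have hMn : M ≤ Real.sqrt n := by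
    rw [Real.le_sqrt hM0.le hn0.le]
    have h1 : (M ^ 2 : ℝ) ≤ ⌈M ^ 2⌉₊ := Nat.le_ceil _
    have h2 : ((⌈M ^ 2⌉₊ + 1 : ℕ) : ℝ) ≤ n := by exact_mod_cast hn
    push_cast at h2
    linarith
  have hsqrt0 : 0 < Real.sqrt n := Real.sqrt_pos.mpr hn0
  have hsq : Real.sqrt (n : ℝ) ^ 2 = n := Real.sq_sqrt hn0.le
  have hsqrt1 : 1 ≤ Real.sqrt n := by
    rw [show (1:ℝ) = Real.sqrt 1 from Real.sqrt_one.symm]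
    exact Real.sqrt_le_sqrt (by exact_mod_cast hn1)
  have h := sq_numStandardTableaux_le_of_durfee n hn1 μ hrow hcol hd
  rw [← hκ] at h
  refine h.trans (mul_le_mul_of_nonneg_left (Real.exp_le_exp.mpr ?_) (Nat.cast_nonneg _))
  -- the exponent bookkeeping: `log n / 2 + 1 - 2κn ≤ -κn`
  have hlog : Real.log n ≤ 2 * Real.sqrt n := by
    have h1 : Real.log (Real.sqrt n) ≤ Real.sqrt n - 1 := Real.log_le_sub_one_of_pos hsqrt0
    rw [Real.log_sqrt hn0.le] at h1
    linarith
  have h1 : 2 * Real.sqrt n ≤ κ * n := by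
    have h3 : κ * M = 2 := by rw [hM]; field_simp
    calc 2 * Real.sqrt n = κ * M * Real.sqrt n := by rw [h3]
      _ ≤ κ * Real.sqrt n * Real.sqrt n :=
          mul_le_mul_of_nonneg_right (mul_le_mul_of_nonneg_left hMn hκ0.le) hsqrt0.le
      _ = κ * n := by rw [mul_assoc, ← sq, hsq]
  rw [show 2 * κ * (n : ℝ) = 2 * (κ * n) by ring]
  linarith

end Summit.MatrixMultiplication.MatrixMultiplication.Theorems

end
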